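import Mathlib
import HarnessLib
import Summits.Parity.BatemanHorn.Theses.AlmostPrimeZeros

/-!
# Route AlmostPrimeZeros — assembly item `Assembly` (stmt-Parity-11325)

The assembly statement of route `route-Parity-AlmostPrimeZeros` is the curried form of the route
file's deciding theorem `closes`:

`SystemZeroRepulsion → HadamardBookkeeping → SystemMertens → NormalityFromRepulsion →
SystemLSDRealSegment → VitaliDerivatives → ExtractionAtZero → BatemanHorn`.

Proof (pure logic, the same four lines as `closes`): fix a Bateman–Horn system `k, f, hf`; take
the limit function `Λ` from the real-segment law `SystemLSDRealSegment`; take `η` and the local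
bounds on the thin rectangle from `NormalityFromRepulsion` fed with the Hadamard bookkeeping, the
system Mertens estimate and the zero repulsion; pass to the `k`-th derivative at `0` with
`VitaliDerivatives`; conclude with `ExtractionAtZero`.
-/

namespace Summit.Parity.BatemanHorn.Theorems

open Summit.Parity.BatemanHorn.Theses.AlmostPrimeZeros

/-- **Assembly of route AlmostPrimeZeros** (stmt-Parity-11325): the seven route items imply
`BatemanHorn`.  This is exactly the route file's deciding theorem `closes`, curried. -/
theorem almostPrimeZeros_assembly_proof : Summit.Parity.BatemanHorn.Theses.AlmostPrimeZeros.Assembly := by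
  unfold Summit.Parity.BatemanHorn.Theses.AlmostPrimeZeros.Assembly
  intro hZ hH hM hN hL hV hE
  exact closes hZ hH hM hN hL hV hE

end Summit.Parity.BatemanHorn.Theorems
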